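import Literature.Analysis.FunctionSpaces.TorusVectorParseval
import Literature.Analysis.FunctionSpaces.TorusTrigPoly
import Literature.Analysis.FunctionSpaces.TorusSobolevNormFacts
import Literature.Analysis.FluidPDE.StatisticalSolutionEnergyEq
import HarnessLib

/-!
# K1L_D (stmt-AnomalousDissipation-27980), stub `stub_oneLevelL_IW`: the DECAY-WEIGHTED ENERGY is a K-functional (S3′ brick)
# (helper; `--supports … --as helper`)

The window ledger pairs the error with a test state `y` whose dissipation over the window is bounded below by the decay-weighted energy
`Q_a(y) = Σ_ℓ min(1, a|ℓ|²)‖ŷ(ℓ)‖²` of its PHYSICAL Fourier coefficients ((E_G) + flat modal decay), while the cell-side bounds (V_G)/(X_G) are stated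
in the FRAME, i.e. for `y ∘ X` with `X` the window's flow map.  Passing between the two needs `Q_a(y∘X) ≤ C·Q_a(y)`, which holds because `Q_a` is a
K-functional between `L²` and `H¹`: this file proves the two Fourier-side halves,
* `decayEnergy_le_of_split`: `Q_a(g₁ + g₂) ≤ 2·(a/4π²)·‖∇g₁‖² + 2·‖g₂‖²` for ANY split (sub-additivity + `min ≤ each`),
* `decayEnergy_ge_split`: `(a/4π²)·‖∇P_N f‖² + ¼‖f − P_N f‖² ≤ Q_a(f)` for the spectral split at `N = ⌊a^{−1/2}⌋` (`0 < a ≤ 1/4`),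
so that with measure preservation (`‖h∘X‖ = ‖h‖`) and the frame gradient bound `‖∇(g∘X)‖² ≤ e^{2C_dθ}‖∇g‖²` (S1′(c)) one gets
`Q_a(f∘X) ≤ 8e^{2C_dθ}·Q_a(f)`.  All quantities in `ℝ≥0∞` (Parseval as tsums); no new definitions.  Infrastructure for rung F-D1.A0; NOT a proof of the
crux or of anomalous dissipation.
-/

set_option linter.dupNamespace false

namespace Summit.AnomalousDissipation.AnomalousDissipation.Theorems.SolenoidalFractalHomogenisation.LagrangianStep

open MeasureTheory Literature.Analysis Literature.Analysis.FluidPDE Literature.Analysis.FunctionSpaces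
open Literature.Analysis.FunctionSpaces.Torus UnitAddTorus
open scoped ENNReal NNReal

/-- **Upper half of the K-functional**: for `g₁, g₂ ∈ L²` and `a ≥ 0`,
`Σ_ℓ min(1, a|ℓ|²)‖𝓕(g₁+g₂)(ℓ)‖² ≤ 2·(a/4π²)·‖∇g₁‖² + 2·∫‖g₂‖²` (in `ℝ≥0∞`). -/
theorem decayEnergy_le_of_split {g₁ g₂ : UnitAddTorus (Fin 3) → EuclideanSpace ℝ (Fin 3)} (hg₁ : MemLp g₁ 2 volume)
    (hg₂ : MemLp g₂ 2 volume) {a : ℝ} (ha : 0 ≤ a) :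
    ∑' ℓ : Fin 3 → ℤ, ENNReal.ofReal (min 1 (a * freqNormSq ℓ)) * ‖mFourierCoeff (EuclideanSpace.complexify ∘ (g₁ + g₂)) ℓ‖ₑ ^ 2
      ≤ 2 * (ENNReal.ofReal (a / (4 * Real.pi ^ 2)) * eGradNormSq g₁) + 2 * ∫⁻ x, ‖g₂ x‖ₑ ^ 2 := by
  have hi₁ : Integrable (EuclideanSpace.complexify ∘ g₁) volume := integrable_complexify_comp (hg₁.integrable one_le_two)
  have hi₂ : Integrable (EuclideanSpace.complexify ∘ g₂) volume := integrable_complexify_comp (hg₂.integrable one_le_two)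
  -- coefficients add
  have hadd : ∀ ℓ, mFourierCoeff (EuclideanSpace.complexify ∘ (g₁ + g₂)) ℓ
      = mFourierCoeff (EuclideanSpace.complexify ∘ g₁) ℓ + mFourierCoeff (EuclideanSpace.complexify ∘ g₂) ℓ := by
    intro ℓ
    have : EuclideanSpace.complexify ∘ (g₁ + g₂) = EuclideanSpace.complexify ∘ g₁ + EuclideanSpace.complexify ∘ g₂ := by
      funext x; simp [map_add]
    rw [this, mFourierCoeff_add hi₁ hi₂]
  -- termwise bound
  have hterm : ∀ ℓ, ENNReal.ofReal (min 1 (a * freqNormSq ℓ)) * ‖mFourierCoeff (EuclideanSpace.complexify ∘ (g₁ + g₂)) ℓ‖ₑ ^ 2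
      ≤ 2 * (ENNReal.ofReal (a / (4 * Real.pi ^ 2)) * (ENNReal.ofReal (4 * Real.pi ^ 2) *
            (ENNReal.ofReal (freqNormSq ℓ) * ‖mFourierCoeff (EuclideanSpace.complexify ∘ g₁) ℓ‖ₑ ^ 2)))
        + 2 * ‖mFourierCoeff (EuclideanSpace.complexify ∘ g₂) ℓ‖ₑ ^ 2 := by
    intro ℓ
    rw [hadd]
    set c₁ := mFourierCoeff (EuclideanSpace.complexify ∘ g₁) ℓ
    set c₂ := mFourierCoeff (EuclideanSpace.complexify ∘ g₂) ℓ
    -- `‖c₁ + c₂‖ₑ² ≤ 2‖c₁‖ₑ² + 2‖c₂‖ₑ²`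
    have hsq : ‖c₁ + c₂‖ₑ ^ 2 ≤ 2 * ‖c₁‖ₑ ^ 2 + 2 * ‖c₂‖ₑ ^ 2 := by
      have h1 : ‖c₁ + c₂‖ₑ ≤ ‖c₁‖ₑ + ‖c₂‖ₑ := enorm_add_le _ _
      calc ‖c₁ + c₂‖ₑ ^ 2 ≤ (‖c₁‖ₑ + ‖c₂‖ₑ) ^ 2 := pow_le_pow_left' h1 2
        _ ≤ 2 * ‖c₁‖ₑ ^ 2 + 2 * ‖c₂‖ₑ ^ 2 := by
            have : (‖c₁‖ₑ + ‖c₂‖ₑ) ^ 2 + (0 : ℝ≥0∞) ≤ 2 * ‖c₁‖ₑ ^ 2 + 2 * ‖c₂‖ₑ ^ 2 + 0 := by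
              -- `(x+y)² ≤ 2x² + 2y²` in `ℝ≥0∞` via `ℝ≥0` when finite; both sides may be `⊤` only together
              rcases eq_or_ne ‖c₁‖ₑ ⊤ with h | h
              · simp [h]
              rcases eq_or_ne ‖c₂‖ₑ ⊤ with h' | h'
              · simp [h']
              lift ‖c₁‖ₑ to ℝ≥0 using h with x
              lift ‖c₂‖ₑ to ℝ≥0 using h' with y
              rw [add_zero, add_zero]
              have hxy : ((x + y) ^ 2 : ℝ≥0) ≤ 2 * x ^ 2 + 2 * y ^ 2 := by
                rw [← NNReal.coe_le_coe]; push_cast; nlinarith [sq_nonneg ((x:ℝ) - y)]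
              exact_mod_cast hxy
            simpa using this
    -- weights: `min ≤ a|ℓ|²` against `c₁`, `min ≤ 1` against `c₂`
    have hw₁ : ENNReal.ofReal (min 1 (a * freqNormSq ℓ)) ≤ ENNReal.ofReal (a / (4 * Real.pi ^ 2)) * (ENNReal.ofReal (4 * Real.pi ^ 2) *
        ENNReal.ofReal (freqNormSq ℓ)) := by
      rw [← ENNReal.ofReal_mul (by positivity), ← ENNReal.ofReal_mul (by positivity)]
      refine ENNReal.ofReal_le_ofReal ?_
      have : a / (4 * Real.pi ^ 2) * (4 * Real.pi ^ 2 * freqNormSq ℓ) = a * freqNormSq ℓ := by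
        field_simp
      rw [this]; exact min_le_right _ _
    have hw₂ : ENNReal.ofReal (min 1 (a * freqNormSq ℓ)) ≤ 1 := by
      rw [← ENNReal.ofReal_one]; exact ENNReal.ofReal_le_ofReal (min_le_left _ _)
    calc ENNReal.ofReal (min 1 (a * freqNormSq ℓ)) * ‖c₁ + c₂‖ₑ ^ 2
        ≤ ENNReal.ofReal (min 1 (a * freqNormSq ℓ)) * (2 * ‖c₁‖ₑ ^ 2 + 2 * ‖c₂‖ₑ ^ 2) := mul_le_mul_of_nonneg_left hsq bot_le
      _ = 2 * (ENNReal.ofReal (min 1 (a * freqNormSq ℓ)) * ‖c₁‖ₑ ^ 2) + 2 * (ENNReal.ofReal (min 1 (a * freqNormSq ℓ)) * ‖c₂‖ₑ ^ 2) := by ring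
      _ ≤ 2 * ((ENNReal.ofReal (a / (4 * Real.pi ^ 2)) * (ENNReal.ofReal (4 * Real.pi ^ 2) * ENNReal.ofReal (freqNormSq ℓ))) * ‖c₁‖ₑ ^ 2)
          + 2 * (1 * ‖c₂‖ₑ ^ 2) := by
          gcongr
      _ = _ := by ring
  -- sum up
  calc ∑' ℓ, ENNReal.ofReal (min 1 (a * freqNormSq ℓ)) * ‖mFourierCoeff (EuclideanSpace.complexify ∘ (g₁ + g₂)) ℓ‖ₑ ^ 2
      ≤ ∑' ℓ, (2 * (ENNReal.ofReal (a / (4 * Real.pi ^ 2)) * (ENNReal.ofReal (4 * Real.pi ^ 2) *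
            (ENNReal.ofReal (freqNormSq ℓ) * ‖mFourierCoeff (EuclideanSpace.complexify ∘ g₁) ℓ‖ₑ ^ 2)))
        + 2 * ‖mFourierCoeff (EuclideanSpace.complexify ∘ g₂) ℓ‖ₑ ^ 2) := ENNReal.tsum_le_tsum hterm
    _ = 2 * (ENNReal.ofReal (a / (4 * Real.pi ^ 2)) * eGradNormSq g₁) + 2 * ∫⁻ x, ‖g₂ x‖ₑ ^ 2 := by
        rw [ENNReal.tsum_add, ENNReal.tsum_mul_left, ENNReal.tsum_mul_left, ENNReal.tsum_mul_left, ENNReal.tsum_mul_left,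
          eGradNormSq_eq_tsum, tsum_enorm_sq_mFourierCoeff_complexify hg₂]

/-- **Lower half of the K-functional (spectral split)**: for `f ∈ L²`, `0 < a ≤ 1/4` and `N := ⌊a^{−1/2}⌋₊`,
`(a/4π²)·‖∇ P_N f‖² + ¼·∫‖f − P_N f‖² ≤ Σ_ℓ min(1, a|ℓ|²)‖𝓕f(ℓ)‖²` (in `ℝ≥0∞`). -/
theorem decayEnergy_ge_split {f : UnitAddTorus (Fin 3) → EuclideanSpace ℝ (Fin 3)} (hf : MemLp f 2 volume)
    {a : ℝ} (ha : 0 < a) (ha4 : a ≤ 1 / 4) :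
    ENNReal.ofReal (a / (4 * Real.pi ^ 2)) * eGradNormSq (fourierTruncate ⌊Real.sqrt a⁻¹⌋₊ f)
        + ENNReal.ofReal (1 / 4) * ∫⁻ x, ‖fourierTruncate ⌊Real.sqrt a⁻¹⌋₊ f x - f x‖ₑ ^ 2
      ≤ ∑' ℓ : Fin 3 → ℤ, ENNReal.ofReal (min 1 (a * freqNormSq ℓ)) * ‖mFourierCoeff (EuclideanSpace.complexify ∘ f) ℓ‖ₑ ^ 2 := by
  classical
  set N : ℕ := ⌊Real.sqrt a⁻¹⌋₊ with hN
  have hint : Integrable f volume := hf.integrable one_le_two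
  set e : (Fin 3 → ℤ) → ℝ≥0∞ := fun ℓ => ‖mFourierCoeff (EuclideanSpace.complexify ∘ f) ℓ‖ₑ ^ 2 with he
  set w : (Fin 3 → ℤ) → ℝ≥0∞ := fun ℓ => ENNReal.ofReal (min 1 (a * freqNormSq ℓ)) with hw
  -- facts about `N`
  have hsa : 0 < Real.sqrt a⁻¹ := Real.sqrt_pos.2 (inv_pos.2 ha)
  have hN_le : (N : ℝ) ≤ Real.sqrt a⁻¹ := Nat.floor_le hsa.le
  have hN_gt : Real.sqrt a⁻¹ < (N : ℝ) + 1 := Nat.lt_floor_add_one _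
  have hsq_inv : Real.sqrt a⁻¹ ^ 2 = a⁻¹ := Real.sq_sqrt (inv_pos.2 ha).le
  have haN2 : a * (N : ℝ) ^ 2 ≤ 1 := by
    have h1 : (N : ℝ) ^ 2 ≤ a⁻¹ := by rw [← hsq_inv]; exact pow_le_pow_left₀ (Nat.cast_nonneg _) hN_le 2
    calc a * (N : ℝ) ^ 2 ≤ a * a⁻¹ := mul_le_mul_of_nonneg_left h1 ha.le
      _ = 1 := mul_inv_cancel₀ ha.ne'
  have haN2' : 1 / 4 ≤ a * ((N : ℝ) ^ 2 + 1) := by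
    -- `√(1/a) < N+1` ⇒ `1/a < (N+1)² ≤ 2N²+2` is too weak; use `√(1/a) ≥ 2` (a ≤ 1/4) ⇒ `N ≥ 1` ⇒ `(N+1)² ≤ 4N² ≤ 4(N²+1)`
    have h2 : (2 : ℝ) ≤ Real.sqrt a⁻¹ := by
      rw [show (2:ℝ) = Real.sqrt 4 by rw [show (4:ℝ) = 2 ^ 2 by norm_num, Real.sqrt_sq (by norm_num)]]
      exact Real.sqrt_le_sqrt (by rw [le_inv_comm₀ (by norm_num) ha]; linarith)
    have hN1 : (1 : ℝ) ≤ N := by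
      have : (1 : ℕ) ≤ N := by
        rw [hN]; exact Nat.le_floor (by simpa using (by linarith : (1:ℝ) ≤ Real.sqrt a⁻¹))
      exact_mod_cast this
    have h3 : a⁻¹ < ((N : ℝ) + 1) ^ 2 := by
      rw [← hsq_inv]; exact pow_lt_pow_left₀ hN_gt hsa.le two_ne_zero
    have h4 : ((N : ℝ) + 1) ^ 2 ≤ 4 * ((N : ℝ) ^ 2 + 1) := by nlinarith
    have h5 : a⁻¹ < 4 * ((N : ℝ) ^ 2 + 1) := h3.trans_le h4
    rw [inv_lt_iff_one_lt_mul₀ ha] at h5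
    linarith
  -- (1) the gradient term as a finite sum over the ball with weights `= w`
  have hG : ENNReal.ofReal (a / (4 * Real.pi ^ 2)) * eGradNormSq (fourierTruncate N f) ≤ ∑ ℓ ∈ freqBall N, w ℓ * e ℓ := by
    rw [eGradNormSq_eq_tsum, ← mul_assoc, ← ENNReal.ofReal_mul (by positivity),
      show a / (4 * Real.pi ^ 2) * (4 * Real.pi ^ 2) = a by field_simp]
    rw [tsum_eq_sum (s := freqBall N) (fun ℓ hℓ => by rw [mFourierCoeff_fourierTruncate hint, if_neg hℓ]; simp), Finset.mul_sum]
    refine Finset.sum_le_sum fun ℓ hℓ => ?_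
    rw [mFourierCoeff_fourierTruncate hint, if_pos hℓ, ← mul_assoc, ← ENNReal.ofReal_mul ha.le]
    refine mul_le_mul_of_nonneg_right (ENNReal.ofReal_le_ofReal ?_) bot_le
    -- on the ball `a|ℓ|² ≤ a N² ≤ 1`, so `min 1 (a|ℓ|²) = a|ℓ|²`
    have hℓ2 : a * freqNormSq ℓ ≤ 1 := (mul_le_mul_of_nonneg_left (mem_freqBall.mp hℓ) ha.le).trans haN2
    rw [min_eq_right hℓ2]
  -- (2) the tail term as a tsum off the ball with weights `≥ 1/4`
  have hT : ENNReal.ofReal (1 / 4) * ∫⁻ x, ‖fourierTruncate N f x - f x‖ₑ ^ 2 ≤ ∑' ℓ : ↥(((freqBall N : Finset (Fin 3 → ℤ)) : Set (Fin 3 → ℤ))ᶜ), w ℓ * e ℓ := by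
    rw [lintegral_enorm_sq_fourierTruncate_sub hf N, ← ENNReal.tsum_mul_left]
    refine ENNReal.tsum_le_tsum fun ℓ => ?_
    refine mul_le_mul_of_nonneg_right (ENNReal.ofReal_le_ofReal ?_) bot_le
    have hℓ : (ℓ : Fin 3 → ℤ) ∉ freqBall N := ℓ.2
    have h1 : (N : ℝ) ^ 2 + 1 ≤ freqNormSq (ℓ : Fin 3 → ℤ) := FluidPDE.Torus.sq_add_one_le_freqNormSq_of_not_mem hℓ
    refine le_min (by norm_num) ?_
    calc (1:ℝ) / 4 ≤ a * ((N : ℝ) ^ 2 + 1) := haN2'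
      _ ≤ a * freqNormSq (ℓ : Fin 3 → ℤ) := mul_le_mul_of_nonneg_left h1 ha.le
  -- (3) add
  calc _ ≤ ∑ ℓ ∈ freqBall N, w ℓ * e ℓ + ∑' ℓ : ↥(((freqBall N : Finset (Fin 3 → ℤ)) : Set (Fin 3 → ℤ))ᶜ), w ℓ * e ℓ := add_le_add hG hT
    _ = ∑' ℓ, w ℓ * e ℓ := ENNReal.sum_add_tsum_compl (freqBall N) (fun ℓ => w ℓ * e ℓ)

end Summit.AnomalousDissipation.AnomalousDissipation.Theorems.SolenoidalFractalHomogenisation.LagrangianStep
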